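import Summits.ValiantsHypothesis.ValiantsHypothesis.Theorems.SymPencilPerFourOneRowToric
import Summits.ValiantsHypothesis.ValiantsHypothesis.Theorems.SymPencilSdcPerFourCellThirteenThree
import Summits.ValiantsHypothesis.ValiantsHypothesis.Theorems.SymPencilPerFourCrossSixTransport

/-!
# Route `SymPencil` — the cell `(13, 3, 0)` of the size-`27` kernel-package table is EMPTY
# (`--supports` stmt-ValiantsHypothesis-5674 `SdcSuperquadratic`; rung currency only — nothing
# here bears on `VP ≠ VNP`)

`SymPencilSdcPerFourCellThirteenThree.toric_of_rank_thirteen_le_twentySeven` reduced the cell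
`(r, dim V, d) = (13, 3, 0)` of the base-point package of a symmetric affine determinantal
representation of `per_4` of size `m ≤ 27` to its TORIC sub-case: the kernel `ker bL` is spanned
by the three matrix units of one row off one column (or of one column off one row).  This file
kills the toric sub-case over an algebraically closed field of characteristic `0`:

* `false_of_toric_row_three`: kernel = row `l` off the column `3` — the row embeddings of
  `SymPencilPerFourOneRowCells`, the Lagrangian invariance
  (`SymPencilLagrangianInvariant.mulVec_mem_range_of_lagrangian`) at every kernel row, and
  `SymPencilPerFourOneRowToric.false_of_oneRow_toric`;
* `false_of_toric_row`, `false_of_toric_col`: any excluded column `j` (a column permutation), and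
  the column version (a transposition), by moving the PACKAGE
  (`SymPencilPerFourCrossSixTransport.package_transport`, `eval_perPoly_comp_prodCongr`,
  `eval_perPoly_transpose`);
* `false_of_rank_thirteen_le_twentySeven`: **the cell `(13, 3, 0)` is empty** (hypotheses exactly
  as exported by `SymPencilPerFourBasePointPackage.basepoint_package_of_isSymm_isAffineDetRepr_perPoly_four`,
  in the format of `SymPencilSdcPerFourCellTenSixClosed.false_of_rank_ten_le_twentySeven`).

Honest framing: TWO of the six cells of the size-`27` table are now closed (`(10,6,6)` and
`(13,3,0)`); the cells `(8,8,10)`, `(9,7,8)`, `(11,5,4)`, `(12,4,2)` remain, so the window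
`27 ≤ sdc(per₄) ≤ 29` is UNCHANGED; stmt-5674 `SdcSuperquadratic` stays OPEN; `VP ≠ VNP` is not
moved; no summit statement is proved here.  No definitions, no named facts. [folklore]
-/

noncomputable section

-- single-conjunct layout: Sub = Summit, duplicated namespace component intended
set_option linter.dupNamespace false

namespace Summit.ValiantsHypothesis.ValiantsHypothesis.Theorems.SymPencilSdcPerFourCellThirteenThreeToric

open Matrix MvPolynomial Module
open Literature.Computability.AlgebraicComplexity
open Summit.ValiantsHypothesis.ValiantsHypothesis.Theorems.SymPencilPerFourOneRowCells
open Summit.ValiantsHypothesis.ValiantsHypothesis.Theorems.SymPencilPerFourOneRowToric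
open Summit.ValiantsHypothesis.ValiantsHypothesis.Theorems.SymPencilLagrangianInvariant
open Summit.ValiantsHypothesis.ValiantsHypothesis.Theorems.SymPencilPerFourCrossSixTransport
open Summit.ValiantsHypothesis.ValiantsHypothesis.Theorems.SymPencilPerFourBlocks
open Summit.ValiantsHypothesis.ValiantsHypothesis.Theorems.SymPencilPerFourTwoRowsRadical
open Summit.ValiantsHypothesis.ValiantsHypothesis.Theorems.SymPencilSdcPerFourCellThirteenThree

universe u

variable {K : Type u} [Field K] [CharZero K] [IsAlgClosed K] {ι' : Type*} [Fintype ι']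
  [DecidableEq ι']

/-- **Toric kernel, normalised**: the kernel `row l off the column 3` is impossible (Lagrangian
package, algebraically closed field of characteristic `0`). [folklore] -/
theorem false_of_toric_row_three {D : Matrix ι' ι' K} (hD : IsUnit D.det) (hDs : Dᵀ = D)
    (bL : (Fin 4 × Fin 4 → K) →ₗ[K] (ι' → K))
    (CL : (Fin 4 × Fin 4 → K) →ₗ[K] Matrix ι' ι' K) (hCs : ∀ z, (CL z)ᵀ = CL z)
    {κ : K} (hκ : κ ≠ 0)
    (hi : ∀ z, bL z ⬝ᵥ D⁻¹ *ᵥ bL z = 0)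
    (hii : ∀ z, bL z ⬝ᵥ (D⁻¹ * CL z * D⁻¹) *ᵥ bL z = 0)
    (hN : ∀ v, bL v = 0 → IsUnit (D + CL v).det ∧ ∀ (z : Fin 4 × Fin 4 → K) (s : K),
      κ * MvPolynomial.eval (v + s • z) (perPoly (Fin 4) K) =
        (Matrix.fromBlocks ((s * 0) • (1 : Matrix Unit Unit K))
          (Matrix.replicateRow Unit (s • bL z)) (Matrix.replicateCol Unit (s • bL z))
          (D + CL v + s • CL z)).det)
    (hL : Fintype.card ι' = 2 * finrank K (LinearMap.range bL))
    (l : Fin 4) (hker : ∀ x, bL x = 0 ↔ (∀ i k : Fin 4, i ≠ l → x (i, k) = 0) ∧ x (l, 3) = 0) :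
    False := by
  classical
  -- the embeddings of the row `l` and of the other rows (as in `SymPencilPerFourOneRowCells`)
  let embV : (Fin 4 → K) →ₗ[K] (Fin 4 × Fin 4 → K) :=
    { toFun := fun w p => if p.1 = l then w p.2 else 0
      map_add' := fun w w' => by
        funext p; simp only [Pi.add_apply]; split_ifs <;> simp
      map_smul' := fun c w => by
        funext p; simp only [Pi.smul_apply, smul_eq_mul, RingHom.id_apply]; split_ifs <;> simp }
  have hembV : ∀ w p, embV w p = if p.1 = l then w p.2 else 0 := fun _ _ => rfl
  let σ := finSuccAboveEquiv l
  have hσ : ∀ a (h : l.succAbove a ≠ l), σ.symm ⟨l.succAbove a, h⟩ = a := fun a h => by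
    rw [Equiv.symm_apply_eq]; exact Subtype.ext (finSuccAboveEquiv_apply l a ▸ rfl)
  let embX : (Fin 3 → Fin 4 → K) →ₗ[K] (Fin 4 × Fin 4 → K) :=
    { toFun := fun x p => if h : p.1 = l then 0 else x (σ.symm ⟨p.1, h⟩) p.2
      map_add' := fun x x' => by
        funext p; simp only [Pi.add_apply]; split_ifs <;> simp
      map_smul' := fun c x => by
        funext p; simp only [Pi.smul_apply, smul_eq_mul, RingHom.id_apply]; split_ifs <;> simp }
  have hembXl : ∀ x j, embX x (l, j) = 0 := fun x j => by
    show (if h : ((l, j) : Fin 4 × Fin 4).1 = l then (0 : K) else _) = 0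
    rw [dif_pos rfl]
  have hembXa : ∀ x a j, embX x (l.succAbove a, j) = x a j := fun x a j => by
    have hne : l.succAbove a ≠ l := Fin.succAbove_ne l a
    show (if h : ((l.succAbove a, j) : Fin 4 × Fin 4).1 = l then (0 : K) else
      x (σ.symm ⟨(l.succAbove a, j).1, h⟩) (l.succAbove a, j).2) = x a j
    rw [dif_neg hne, hσ a hne]
  have hdecomp : ∀ z : Fin 4 × Fin 4 → K,
      z = embV (fun j => z (l, j)) + embX (fun a j => z (l.succAbove a, j)) := by
    intro z
    funext ⟨i, j⟩
    rcases Fin.eq_self_or_eq_succAbove l i with rfl | ⟨a, rfl⟩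
    · rw [Pi.add_apply, hembXl, hembV, if_pos rfl, add_zero]
    · rw [Pi.add_apply, hembXa, hembV, if_neg (Fin.succAbove_ne _ a), zero_add]
  -- every row `w` with `w 3 = 0` is a kernel row
  have hH : ∀ w : Fin 4 → K, w 3 = 0 → bL (embV w) = 0 := fun w hw =>
    (hker _).2 ⟨fun i k hil => by rw [hembV, if_neg hil], by rw [hembV, if_pos rfl]; exact hw⟩
  -- `im bL` is spanned by the other rows and `bL (embV e₃)`
  have hEXr : ∀ z, ∃ (x : Fin 3 → Fin 4 → K) (c : K),
      bL (embX x) + c • bL (embV (Pi.single 3 1)) = bL z := by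
    intro z
    refine ⟨fun a j => z (l.succAbove a, j), z (l, 3), ?_⟩
    have hrow : (fun j => z (l, j)) =
        ((fun j => z (l, j)) - z (l, 3) • (Pi.single 3 1 : Fin 4 → K)) +
          z (l, 3) • (Pi.single 3 1 : Fin 4 → K) := by
      rw [sub_add_cancel]
    have hzero : bL (embV ((fun j => z (l, j)) - z (l, 3) • (Pi.single 3 1 : Fin 4 → K))) = 0 :=
      hH _ (by simp)
    conv_rhs => rw [hdecomp z, hrow]
    rw [map_add bL, map_add embV, map_add bL, hzero, zero_add, map_smul, map_smul, add_comm]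
  have hinv : ∀ w : Fin 4 → K, w 3 = 0 → ∀ y ∈ LinearMap.range bL,
      CL (embV w) *ᵥ (D⁻¹ *ᵥ y) ∈ LinearMap.range bL := fun w hw y hy =>
    mulVec_mem_range_of_lagrangian hD hDs bL CL hCs hi hii hL (embV w) (hH w hw) y hy
  have hper : ∀ (w : Fin 4 → K) (x : Fin 3 → Fin 4 → K) (s : K),
      MvPolynomial.eval (embV w + s • embX x) (perPoly (Fin 4) K) =
        s ^ 3 * (Matrix.of ![w, x 0, x 1, x 2]).permanent := by
    intro w x s
    rw [eval_perPoly]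
    refine permanent_of_row_data l _ w x s (fun j => ?_) (fun a j => ?_)
    · rw [Matrix.of_apply, Pi.add_apply, Pi.smul_apply, hembV, if_pos rfl, hembXl, smul_zero,
        add_zero]
    · rw [Matrix.of_apply, Pi.add_apply, Pi.smul_apply, hembV, if_neg (Fin.succAbove_ne l a),
        hembXa, smul_eq_mul, zero_add]
  exact false_of_oneRow_toric hD hDs bL CL hCs hκ hii hN embV embX (Pi.single 3 1) hH hEXr hinv
    hper

/-- **Toric kernel in a row**: the kernel `row l off the column j` is impossible (column
permutation of `false_of_toric_row_three` by transport of the package). [folklore] -/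
theorem false_of_toric_row {D : Matrix ι' ι' K} (hD : IsUnit D.det) (hDs : Dᵀ = D)
    (bL : (Fin 4 × Fin 4 → K) →ₗ[K] (ι' → K))
    (CL : (Fin 4 × Fin 4 → K) →ₗ[K] Matrix ι' ι' K) (hCs : ∀ z, (CL z)ᵀ = CL z)
    {κ : K} (hκ : κ ≠ 0)
    (hi : ∀ z, bL z ⬝ᵥ D⁻¹ *ᵥ bL z = 0)
    (hii : ∀ z, bL z ⬝ᵥ (D⁻¹ * CL z * D⁻¹) *ᵥ bL z = 0)
    (hN : ∀ v, bL v = 0 → IsUnit (D + CL v).det ∧ ∀ (z : Fin 4 × Fin 4 → K) (s : K),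
      κ * MvPolynomial.eval (v + s • z) (perPoly (Fin 4) K) =
        (Matrix.fromBlocks ((s * 0) • (1 : Matrix Unit Unit K))
          (Matrix.replicateRow Unit (s • bL z)) (Matrix.replicateCol Unit (s • bL z))
          (D + CL v + s • CL z)).det)
    (hL : Fintype.card ι' = 2 * finrank K (LinearMap.range bL))
    (l j : Fin 4) (hker : ∀ x, bL x = 0 ↔ (∀ i k : Fin 4, i ≠ l → x (i, k) = 0) ∧ x (l, j) = 0) :
    False := by
  classical
  set τ : Equiv.Perm (Fin 4) := Equiv.swap j 3 with hτ
  set Φ : (Fin 4 × Fin 4 → K) ≃ₗ[K] (Fin 4 × Fin 4 → K) :=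
    LinearEquiv.funCongrLeft K K (Equiv.prodCongr (Equiv.refl (Fin 4)) τ) with hΦ
  have hΦap : ∀ (z : Fin 4 × Fin 4 → K) (i k : Fin 4), Φ z (i, k) = z (i, τ k) := fun z i k => rfl
  have hΦz : ∀ z : Fin 4 × Fin 4 → K, Φ z = z ∘ (Equiv.prodCongr (Equiv.refl (Fin 4)) τ) :=
    fun z => rfl
  have hN' := package_transport bL CL hN Φ 1 fun z => by
    rw [one_mul, hΦz]
    exact eval_perPoly_comp_prodCongr (Equiv.refl (Fin 4)) τ z
  have hrange : LinearMap.range (bL ∘ₗ Φ.toLinearMap) = LinearMap.range bL :=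
    LinearMap.range_comp_of_range_eq_top _ Φ.range
  refine false_of_toric_row_three hD hDs (bL ∘ₗ Φ.toLinearMap) (CL ∘ₗ Φ.toLinearMap)
    (fun z => hCs _) (mul_ne_zero one_ne_zero hκ) (fun z => hi _) (fun z => hii _) hN'
    (by rw [hrange]; exact hL) l fun x => ?_
  rw [LinearMap.comp_apply, LinearEquiv.coe_coe, hker]
  simp only [hΦap]
  have hτj : τ j = 3 := by rw [hτ, Equiv.swap_apply_left]
  rw [hτj]
  constructor
  · rintro ⟨h1, h2⟩
    refine ⟨fun i k hil => ?_, h2⟩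
    have h := h1 i (τ k) hil
    rwa [hτ, Equiv.swap_apply_self] at h
  · rintro ⟨h1, h2⟩
    exact ⟨fun i k hil => h1 i (τ k) hil, h2⟩

/-- **Toric kernel in a column**: the kernel `column c off the row i` is impossible (transpose
and permutation of `false_of_toric_row_three` by transport of the package). [folklore] -/
theorem false_of_toric_col {D : Matrix ι' ι' K} (hD : IsUnit D.det) (hDs : Dᵀ = D)
    (bL : (Fin 4 × Fin 4 → K) →ₗ[K] (ι' → K))
    (CL : (Fin 4 × Fin 4 → K) →ₗ[K] Matrix ι' ι' K) (hCs : ∀ z, (CL z)ᵀ = CL z)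
    {κ : K} (hκ : κ ≠ 0)
    (hi : ∀ z, bL z ⬝ᵥ D⁻¹ *ᵥ bL z = 0)
    (hii : ∀ z, bL z ⬝ᵥ (D⁻¹ * CL z * D⁻¹) *ᵥ bL z = 0)
    (hN : ∀ v, bL v = 0 → IsUnit (D + CL v).det ∧ ∀ (z : Fin 4 × Fin 4 → K) (s : K),
      κ * MvPolynomial.eval (v + s • z) (perPoly (Fin 4) K) =
        (Matrix.fromBlocks ((s * 0) • (1 : Matrix Unit Unit K))
          (Matrix.replicateRow Unit (s • bL z)) (Matrix.replicateCol Unit (s • bL z))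
          (D + CL v + s • CL z)).det)
    (hL : Fintype.card ι' = 2 * finrank K (LinearMap.range bL))
    (c i : Fin 4) (hker : ∀ x, bL x = 0 ↔ (∀ k j : Fin 4, j ≠ c → x (k, j) = 0) ∧ x (i, c) = 0) :
    False := by
  classical
  set τ : Equiv.Perm (Fin 4) := Equiv.swap i 3 with hτ
  set e : Fin 4 × Fin 4 ≃ Fin 4 × Fin 4 :=
    (Equiv.prodComm (Fin 4) (Fin 4)).trans (Equiv.prodCongr (Equiv.refl (Fin 4)) τ) with he
  have he_apply : ∀ p : Fin 4 × Fin 4, e p = (p.2, τ p.1) := fun p => by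
    obtain ⟨a, b⟩ := p
    rfl
  set Φ : (Fin 4 × Fin 4 → K) ≃ₗ[K] (Fin 4 × Fin 4 → K) := LinearEquiv.funCongrLeft K K e with hΦ
  have hΦap : ∀ (z : Fin 4 × Fin 4 → K) (k j' : Fin 4), Φ z (k, j') = z (j', τ k) := fun z k j' => rfl
  have hΦinv : ∀ z : Fin 4 × Fin 4 → K,
      MvPolynomial.eval (Φ z) (perPoly (Fin 4) K) = MvPolynomial.eval z (perPoly (Fin 4) K) := by
    intro z
    have h1 : Φ z = LinearEquiv.funCongrLeft K K (Equiv.prodComm (Fin 4) (Fin 4))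
        (z ∘ (Equiv.prodCongr (Equiv.refl (Fin 4)) τ)) := by
      ext p
      obtain ⟨a, b⟩ := p
      rfl
    rw [h1, eval_perPoly_transpose, eval_perPoly_comp_prodCongr]
  have hN' := package_transport bL CL hN Φ 1 fun z => by rw [one_mul]; exact hΦinv z
  have hrange : LinearMap.range (bL ∘ₗ Φ.toLinearMap) = LinearMap.range bL :=
    LinearMap.range_comp_of_range_eq_top _ Φ.range
  refine false_of_toric_row_three hD hDs (bL ∘ₗ Φ.toLinearMap) (CL ∘ₗ Φ.toLinearMap)
    (fun z => hCs _) (mul_ne_zero one_ne_zero hκ) (fun z => hi _) (fun z => hii _) hN'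
    (by rw [hrange]; exact hL) c fun x => ?_
  rw [LinearMap.comp_apply, LinearEquiv.coe_coe, hker]
  simp only [hΦap]
  have hτi : τ i = 3 := by rw [hτ, Equiv.swap_apply_left]
  rw [hτi]
  constructor
  · rintro ⟨h1, h2⟩
    refine ⟨fun i' k hil => ?_, h2⟩
    have h := h1 (τ k) i' hil
    rwa [hτ, Equiv.swap_apply_self] at h
  · rintro ⟨h1, h2⟩
    exact ⟨fun k j' hjc => h1 j' (τ k) hjc, h2⟩

/-- **THE CELL `(13, 3, 0)` IS EMPTY**: no base-point package of a symmetric affine determinantal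
representation of `per_4` of size `m ≤ 27` over an algebraically closed field of characteristic
`0` has a `13`-dimensional space of kernel rows (hypotheses exactly as exported by
`SymPencilPerFourBasePointPackage.basepoint_package_of_isSymm_isAffineDetRepr_perPoly_four`).
[folklore] -/
theorem false_of_rank_thirteen_le_twentySeven (K : Type*) [Field K] [CharZero K] [IsAlgClosed K]
    {m : ℕ} (hm : m ≤ 27)
    {i₀ : Fin m} {D : Matrix {i // i ≠ i₀} {i // i ≠ i₀} K}
    {bL : (Fin 4 × Fin 4 → K) →ₗ[K] ({i // i ≠ i₀} → K)}
    {CL : (Fin 4 × Fin 4 → K) →ₗ[K] Matrix {i // i ≠ i₀} {i // i ≠ i₀} K} {κ : K}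
    (hD : IsUnit D.det) (hDs : Dᵀ = D) (hCs : ∀ z, (CL z)ᵀ = CL z) (hκ : κ ≠ 0)
    (hi : ∀ z, bL z ⬝ᵥ D⁻¹ *ᵥ bL z = 0)
    (hii : ∀ z, bL z ⬝ᵥ (D⁻¹ * CL z * D⁻¹) *ᵥ bL z = 0)
    (hiii : ∀ z, D.det * (bL z ⬝ᵥ (D⁻¹ * CL z * D⁻¹ * CL z * D⁻¹) *ᵥ bL z) =
      -(κ * eval z (perPoly (Fin 4) K)))
    (hcard : Fintype.card {i // i ≠ i₀} + 1 = m)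
    (hranle : 2 * finrank K (LinearMap.range bL) ≤ Fintype.card {i // i ≠ i₀})
    (hrn : finrank K (LinearMap.range bL) + finrank K (LinearMap.ker bL) = 16)
    (hN : ∀ v, bL v = 0 → IsUnit (D + CL v).det ∧ ∀ (z : Fin 4 × Fin 4 → K) (s : K),
      κ * eval (v + s • z) (perPoly (Fin 4) K) =
        (Matrix.fromBlocks ((s * 0) • (1 : Matrix Unit Unit K))
          (Matrix.replicateRow Unit (s • bL z)) (Matrix.replicateCol Unit (s • bL z))
          (D + CL v + s • CL z)).det)
    (h13 : finrank K (LinearMap.range bL) = 13) : False := by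
  have hL : Fintype.card {i // i ≠ i₀} = 2 * finrank K (LinearMap.range bL) := by omega
  rcases toric_of_rank_thirteen_le_twentySeven K hm hD hDs hCs hκ hi hii hiii hcard hranle hrn hN
    h13 with ⟨l, j, hker⟩ | ⟨c, i, hker⟩
  · exact false_of_toric_row hD hDs bL CL hCs hκ hi hii hN hL l j hker
  · exact false_of_toric_col hD hDs bL CL hCs hκ hi hii hN hL c i hker

end Summit.ValiantsHypothesis.ValiantsHypothesis.Theorems.SymPencilSdcPerFourCellThirteenThreeToric

end
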